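import Summits.NavierStokesRegularity.NavierStokesRegularity.Theorems.AxisymmetricExtremalityAxisymmetricKatoGlobalStubSeregin2020TypeIILemma22ExcisionBallCutoffs
import Literature.Analysis.FluidPDE.SqIntegralBalance
import Mathlib.Analysis.Calculus.Deriv.MeanValue
import HarnessLib

/-!
# Seregin 2020, Lemma 2.2 — L22-B (energy class across `S`), F3c piece: slice masses of the cut
# test functions (measurability, monotonicity, near-mass, junction jump)

Helper toward the stub `stub_seregin2020TypeII` of the crux `AxisymmetricKatoGlobal` (= the named
fact `Literature.Analysis.FluidPDE.Seregin2020_axisymmetricSingularPoint_typeII`, G. Seregin,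
Anal. Math. Phys. 10 (2020) Paper 46 = arXiv:2006.04140, Thm 2.1), reduced in the tree to the
corrected Lemma 2.2 (`hWH′`), whose remaining analytic input L22-B is the energy-inequality class
(Nazarov–Uraltseva 2012 (3.3); Seregin 2020 §3) of the normalised class-𝒱 pair across the axis and
the `𝒫¹`-null set `S`. This file is the hand-over piece kits/A1-L22B-F3c-sliceMasses.md of the
cell's F3c assembly (`telescope_pieces`): on a time slice `t < 0`, for the masses
`M_A(t) = ∫ H(Φ̃(t,y)) (Θ(y) ∏_{i∈A}(1-ψᵢ(y)))² dy` of the test function cut by the active balls,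

* `sliceNormalised_measurable_bounds` — `y ↦ Φ̃(t,y)` is measurable and `0 ≤ H(Φ̃) ≤ H(0)`;
* `prodCut_sq_pointwise` — `0 ≤ 1 - ∏_A(1-ψᵢ)² ≤ ∑_{i∈A} 1_{B(xᵢ,4rᵢ)}` and the switching bound
  `|∏_A(1-ψᵢ)² - ∏_B(1-ψᵢ)²| ≤ ∑_{A∖B} 1_{B(xᵢ,4rᵢ)} + ∑_{B∖A} 1_{B(xᵢ,4rᵢ)}` (es-p1's
  `one_sub_prod_le_sum`, `abs_prod_sub_prod_le`, `one_sub_sq_le_indicator`);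
* `sliceMass_integrable` — `M_A(t)` is a Bochner integral of an integrable function;
* `sliceMass_prodCut_facts` — the four facts of the kit, verbatim: integrability, `M_A ≤ M_∅`,
  near-mass `M_∅ - M_A ≤ H(0) CΘ² ∑_{i∈A} |B(xᵢ,4rᵢ)|`, junction jump
  `|M_A - M_B| ≤ H(0) CΘ² (∑_{A∖B} + ∑_{B∖A}) |B(xᵢ,4rᵢ)|`.

No NS regularity statement is proved here.

## References

* G. Seregin, Anal. Math. Phys. 10 (2020), Paper 46 = arXiv:2006.04140, §3 (passage across the
  axis), Lemma 2.2. [Seregin2020]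
* A. I. Nazarov, N. N. Uraltseva, St. Petersburg Math. J. 23 (2012) 93–115 = arXiv:1011.1888,
  (3.3) and Remark 9. [NazarovUraltseva2012]
-/

-- the problem directory repeats the summit name (D-0017); core's `dupNamespace` linter fires
set_option linter.dupNamespace false

noncomputable section

open MeasureTheory Set Function Filter Topology TopologicalSpace Metric
open scoped NNReal ENNReal

namespace Summit.NavierStokesRegularity.NavierStokesRegularity.Theorems.AxisymmetricKatoGlobal.EulerScaling

open Literature.Analysis.FluidPDE

/-- On a time slice `t < 0`, the normalised `Φ̃(t,·)` (`= Φ(t,·)` off the closed set `S`, `= k` on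
it) is measurable, and `0 ≤ H(Φ̃(t,y)) ≤ H(0)` for `H ≥ 0` nonincreasing, since `Φ̃ ≥ 0`. [folklore] -/
theorem sliceNormalised_measurable_bounds
    {Φ Φ' : ℝ → EuclideanSpace ℝ (Fin 3) → ℝ} {S : Set (ℝ × EuclideanSpace ℝ (Fin 3))} {k : ℝ}
    (hSc : IsClosed S)
    (hΦc : ContinuousOn (uncurry Φ) ({z : ℝ × EuclideanSpace ℝ (Fin 3) | z.1 < 0} \ S))
    (hΦ0 : ∀ z : ℝ × EuclideanSpace ℝ (Fin 3), z.1 < 0 → z ∉ S → 0 ≤ Φ z.1 z.2) (hk : 0 < k)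
    (hΦ'1 : ∀ t x, t < 0 → (t, x) ∉ S → Φ' t x = Φ t x) (hΦ'2 : ∀ t x, ¬ (t < 0 ∧ (t, x) ∉ S) → Φ' t x = k)
    {H : ℝ → ℝ} (hH : ContDiff ℝ 2 H) (hH' : ∀ v, deriv H v ≤ 0) (hH0 : ∀ v, 0 ≤ H v)
    {t : ℝ} (ht : t < 0) :
    Measurable (Φ' t) ∧ ∀ y, 0 ≤ H (Φ' t y) ∧ H (Φ' t y) ≤ H 0 := by
  classical
  have hcl : IsClosed {y : EuclideanSpace ℝ (Fin 3) | (t, y) ∈ S} := hSc.preimage (Continuous.prodMk_right t)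
  have hO : IsOpen {y : EuclideanSpace ℝ (Fin 3) | (t, y) ∉ S} := isOpen_compl_iff.2 hcl
  have hcont : ContinuousOn (Φ t) {y : EuclideanSpace ℝ (Fin 3) | (t, y) ∉ S} :=
    hΦc.comp (Continuous.prodMk_right t).continuousOn fun y hy => ⟨ht, hy⟩
  have hpw : Φ' t = {y : EuclideanSpace ℝ (Fin 3) | (t, y) ∉ S}.piecewise (Φ t) (fun _ => k) := by
    funext y
    by_cases hy : y ∈ {y : EuclideanSpace ℝ (Fin 3) | (t, y) ∉ S}
    · rw [piecewise_eq_of_mem _ _ _ hy]; exact hΦ'1 t y ht hy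
    · rw [piecewise_eq_of_notMem _ _ _ hy]; exact hΦ'2 t y fun h => hy h.2
  have hanti : Antitone H := antitone_of_deriv_nonpos (hH.differentiable (by norm_num)) hH'
  refine ⟨by rw [hpw]; exact ContinuousOn.measurable_piecewise hcont continuousOn_const hO.measurableSet,
    fun y => ⟨hH0 _, hanti ?_⟩⟩
  by_cases h : t < 0 ∧ (t, y) ∉ S
  · rw [hΦ'1 t y h.1 h.2]; exact hΦ0 (t, y) h.1 h.2
  · rw [hΦ'2 t y h]; exact hk.le

/-- Pointwise facts for the squared product cut-offs `∏_{i∈A}(1-ψᵢ)²` of bumps with values in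
`[0,1]` vanishing off `B(xᵢ, 4rᵢ)`: values in `[0,1]`, `0 ≤ 1 - ∏_A(1-ψᵢ)² ≤ ∑_{i∈A} 1_{B(xᵢ,4rᵢ)}`,
and the switching bound `|∏_A(1-ψᵢ)² - ∏_B(1-ψᵢ)²| ≤ ∑_{A∖B} 1_{B(xᵢ,4rᵢ)} + ∑_{B∖A} 1_{B(xᵢ,4rᵢ)}`
(es-p1's `one_sub_prod_le_sum`, `abs_prod_sub_prod_le`, `one_sub_sq_le_indicator`). [folklore] -/
theorem prodCut_sq_pointwise {s A B : Finset ℕ} {ψ : ℕ → EuclideanSpace ℝ (Fin 3) → ℝ}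
    {x : ℕ → EuclideanSpace ℝ (Fin 3)} {r : ℕ → ℝ}
    (hψ01 : ∀ i ∈ s, ∀ y, 0 ≤ ψ i y ∧ ψ i y ≤ 1)
    (hψ0 : ∀ i ∈ s, ∀ y, y ∉ ball (x i) (4 * r i) → ψ i y = 0) (hA : A ⊆ s) (hB : B ⊆ s)
    (y : EuclideanSpace ℝ (Fin 3)) :
    (0 ≤ (∏ i ∈ A, (1 - ψ i y)) ^ 2 ∧ (∏ i ∈ A, (1 - ψ i y)) ^ 2 ≤ 1) ∧
    (0 ≤ 1 - (∏ i ∈ A, (1 - ψ i y)) ^ 2 ∧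
      1 - (∏ i ∈ A, (1 - ψ i y)) ^ 2 ≤ ∑ i ∈ A, (ball (x i) (4 * r i)).indicator (fun _ => (1 : ℝ)) y) ∧
    |(∏ i ∈ A, (1 - ψ i y)) ^ 2 - (∏ i ∈ B, (1 - ψ i y)) ^ 2| ≤
      ∑ i ∈ A \ B, (ball (x i) (4 * r i)).indicator (fun _ => (1 : ℝ)) y +
        ∑ i ∈ B \ A, (ball (x i) (4 * r i)).indicator (fun _ => (1 : ℝ)) y := by
  have h01 : ∀ i ∈ s, 0 ≤ (1 - ψ i y) ^ 2 ∧ (1 - ψ i y) ^ 2 ≤ 1 := fun i hi =>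
    one_sub_sq_mem_unitInterval (fun y => (hψ01 i hi y).1) (fun y => (hψ01 i hi y).2) y
  have hind : ∀ i ∈ s, 0 ≤ 1 - (1 - ψ i y) ^ 2 ∧
      1 - (1 - ψ i y) ^ 2 ≤ (ball (x i) (4 * r i)).indicator (fun _ => (1 : ℝ)) y := fun i hi =>
    one_sub_sq_le_indicator (fun y => (hψ01 i hi y).1) (fun y => (hψ01 i hi y).2) (hψ0 i hi) y
  rw [← Finset.prod_pow, ← Finset.prod_pow]
  have hPA0 : 0 ≤ ∏ i ∈ A, (1 - ψ i y) ^ 2 := Finset.prod_nonneg fun i hi => (h01 i (hA hi)).1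
  have hPA1 : ∏ i ∈ A, (1 - ψ i y) ^ 2 ≤ 1 :=
    Finset.prod_le_one (fun i hi => (h01 i (hA hi)).1) fun i hi => (h01 i (hA hi)).2
  refine ⟨⟨hPA0, hPA1⟩, ⟨by linarith, ?_⟩, ?_⟩
  · exact (one_sub_prod_le_sum A (fun i => (1 - ψ i y) ^ 2) fun i hi => h01 i (hA hi)).trans
      (Finset.sum_le_sum fun i hi => (hind i (hA hi)).2)
  · have hU : ∀ i ∈ A ∪ B, 0 ≤ (1 - ψ i y) ^ 2 ∧ (1 - ψ i y) ^ 2 ≤ 1 := fun i hi => by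
      rcases Finset.mem_union.1 hi with h | h
      · exact h01 i (hA h)
      · exact h01 i (hB h)
    refine (abs_prod_sub_prod_le A B (fun i => (1 - ψ i y) ^ 2) hU).trans (add_le_add ?_ ?_)
    · exact Finset.sum_le_sum fun i hi => (hind i (hA (Finset.mem_sdiff.1 hi).1)).2
    · exact Finset.sum_le_sum fun i hi => (hind i (hB (Finset.mem_sdiff.1 hi).1)).2

/-- Integrability of the cut slice mass integrand `y ↦ H(Φ̃(t,y)) (Θ(y) ∏_{i∈D}(1-ψᵢ(y)))²`:
a bounded measurable factor times a continuous compactly supported one. [folklore] -/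
theorem sliceMass_integrable
    {Φ Φ' : ℝ → EuclideanSpace ℝ (Fin 3) → ℝ} {S : Set (ℝ × EuclideanSpace ℝ (Fin 3))} {k : ℝ}
    (hSc : IsClosed S)
    (hΦc : ContinuousOn (uncurry Φ) ({z : ℝ × EuclideanSpace ℝ (Fin 3) | z.1 < 0} \ S))
    (hΦ0 : ∀ z : ℝ × EuclideanSpace ℝ (Fin 3), z.1 < 0 → z ∉ S → 0 ≤ Φ z.1 z.2) (hk : 0 < k)
    (hΦ'1 : ∀ t x, t < 0 → (t, x) ∉ S → Φ' t x = Φ t x) (hΦ'2 : ∀ t x, ¬ (t < 0 ∧ (t, x) ∉ S) → Φ' t x = k)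
    {H : ℝ → ℝ} (hH : ContDiff ℝ 2 H) (hH' : ∀ v, deriv H v ≤ 0) (hH0 : ∀ v, 0 ≤ H v)
    {Θ : EuclideanSpace ℝ (Fin 3) → ℝ} (hΘ : ContDiff ℝ 1 Θ) (hΘc : HasCompactSupport Θ)
    {s : Finset ℕ} {ψ : ℕ → EuclideanSpace ℝ (Fin 3) → ℝ} (hψc : ∀ i ∈ s, Continuous (ψ i))
    {t : ℝ} (ht : t < 0) {D : Finset ℕ} (hD : D ⊆ s) :
    Integrable (fun y => H (Φ' t y) * (Θ y * ∏ i ∈ D, (1 - ψ i y)) ^ 2) := by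
  obtain ⟨hmeas, hbd⟩ := sliceNormalised_measurable_bounds hSc hΦc hΦ0 hk hΦ'1 hΦ'2 hH hH' hH0 ht
  have hgc : Continuous fun y => (Θ y * ∏ i ∈ D, (1 - ψ i y)) ^ 2 :=
    (hΘ.continuous.mul (continuous_finsetProd _ fun i hi => continuous_const.sub (hψc i (hD hi)))).pow 2
  have hgs : HasCompactSupport fun y => (Θ y * ∏ i ∈ D, (1 - ψ i y)) ^ 2 := by
    refine hΘc.mono fun y hy => ?_
    rw [mem_support] at hy ⊢
    intro h0; apply hy; rw [h0, zero_mul, zero_pow two_ne_zero]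
  have hHm : AEStronglyMeasurable (fun y => H (Φ' t y)) volume :=
    (hH.continuous.measurable.comp hmeas).aestronglyMeasurable
  refine (hgc.integrable_of_hasCompactSupport hgs).bdd_mul hHm (c := H 0) (Eventually.of_forall fun y => ?_)
  rw [Real.norm_eq_abs, abs_of_nonneg (hbd y).1]; exact (hbd y).2

/-- **Slice masses of the cut test functions (kits/A1-L22B-F3c-sliceMasses.md, verbatim).** On a
time slice `t < 0`, for the masses `M_A = ∫ H(Φ̃(t,y)) (Θ(y)∏_{i∈A}(1-ψᵢ(y)))² dy` cut by the
active balls: (1) the integrand is integrable; (2) `M_A ≤ M_∅ = ∫ H(Φ̃)Θ²`; (3) near-mass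
`M_∅ - M_A ≤ H(0)·CΘ²·∑_{i∈A} |B(xᵢ,4rᵢ)|`; (4) junction jump
`|M_A - M_B| ≤ H(0)·CΘ²·(∑_{i∈A∖B} + ∑_{i∈B∖A}) |B(xᵢ,4rᵢ)|`. Here `S` is closed on the axis,
`Φ ≥ 0` is continuous on `{t<0} ∖ S`, `Φ̃` its normalisation (two pointwise clauses), `H ∈ C²`,
`H' ≤ 0 ≤ H`, `Θ ∈ C¹_c`, `|Θ| ≤ CΘ`, bumps `ψᵢ ∈ C`, values in `[0,1]`, `= 0` off `B(xᵢ,4rᵢ)`.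
[cite: Seregin2020, §3 pp. 9–10; NazarovUraltseva2012, (3.3), Remark 9] -/
theorem sliceMass_prodCut_facts
    {Φ Φ' : ℝ → EuclideanSpace ℝ (Fin 3) → ℝ} {S : Set (ℝ × EuclideanSpace ℝ (Fin 3))} {k : ℝ}
    (hSc : IsClosed S) (hSax : ∀ z ∈ S, z.1 ≤ 0 ∧ cylRadius z.2 = 0)
    (hΦc : ContinuousOn (uncurry Φ) ({z : ℝ × EuclideanSpace ℝ (Fin 3) | z.1 < 0} \ S))
    (hΦ0 : ∀ z : ℝ × EuclideanSpace ℝ (Fin 3), z.1 < 0 → z ∉ S → 0 ≤ Φ z.1 z.2) (hk : 0 < k)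
    (hΦ'1 : ∀ t x, t < 0 → (t, x) ∉ S → Φ' t x = Φ t x) (hΦ'2 : ∀ t x, ¬ (t < 0 ∧ (t, x) ∉ S) → Φ' t x = k)
    {H : ℝ → ℝ} (hH : ContDiff ℝ 2 H) (hH' : ∀ v, deriv H v ≤ 0) (hH0 : ∀ v, 0 ≤ H v)
    {Θ : EuclideanSpace ℝ (Fin 3) → ℝ} (hΘ : ContDiff ℝ 1 Θ) (hΘc : HasCompactSupport Θ) {CΘ : ℝ} (hCΘ : ∀ y, |Θ y| ≤ CΘ)
    {s : Finset ℕ} {ψ : ℕ → EuclideanSpace ℝ (Fin 3) → ℝ} {x : ℕ → EuclideanSpace ℝ (Fin 3)} {r : ℕ → ℝ}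
    (hψc : ∀ i ∈ s, Continuous (ψ i)) (hψ01 : ∀ i ∈ s, ∀ y, 0 ≤ ψ i y ∧ ψ i y ≤ 1)
    (hψ0 : ∀ i ∈ s, ∀ y, y ∉ ball (x i) (4 * r i) → ψ i y = 0)
    {t : ℝ} (ht : t < 0) {A B : Finset ℕ} (hA : A ⊆ s) (hB : B ⊆ s) :
    Integrable (fun y => H (Φ' t y) * (Θ y * ∏ i ∈ A, (1 - ψ i y)) ^ 2) ∧
    (∫ y, H (Φ' t y) * (Θ y * ∏ i ∈ A, (1 - ψ i y)) ^ 2) ≤ (∫ y, H (Φ' t y) * Θ y ^ 2) ∧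
    (∫ y, H (Φ' t y) * Θ y ^ 2) - (∫ y, H (Φ' t y) * (Θ y * ∏ i ∈ A, (1 - ψ i y)) ^ 2)
      ≤ H 0 * CΘ ^ 2 * ∑ i ∈ A, volume.real (ball (x i) (4 * r i)) ∧
    |(∫ y, H (Φ' t y) * (Θ y * ∏ i ∈ A, (1 - ψ i y)) ^ 2) - (∫ y, H (Φ' t y) * (Θ y * ∏ i ∈ B, (1 - ψ i y)) ^ 2)|
      ≤ H 0 * CΘ ^ 2 * (∑ i ∈ A \ B, volume.real (ball (x i) (4 * r i)) + ∑ i ∈ B \ A, volume.real (ball (x i) (4 * r i))) := by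
  have _hax := hSax
  obtain ⟨-, hbd⟩ := sliceNormalised_measurable_bounds hSc hΦc hΦ0 hk hΦ'1 hΦ'2 hH hH' hH0 ht
  have hI : ∀ D : Finset ℕ, D ⊆ s → Integrable (fun y => H (Φ' t y) * (Θ y * ∏ i ∈ D, (1 - ψ i y)) ^ 2) :=
    fun D hD => sliceMass_integrable hSc hΦc hΦ0 hk hΦ'1 hΦ'2 hH hH' hH0 hΘ hΘc hψc ht hD
  have hIA := hI A hA
  have hIB := hI B hB
  have hI0 : Integrable (fun y => H (Φ' t y) * Θ y ^ 2) := by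
    have h := hI ∅ (Finset.empty_subset _)
    simpa only [Finset.prod_empty, mul_one] using h
  -- pointwise facts
  have hpt := fun y => prodCut_sq_pointwise hψ01 hψ0 hA hB y
  have hCΘ0 : 0 ≤ CΘ := (abs_nonneg _).trans (hCΘ (x 0))
  have hΘsq : ∀ y, Θ y ^ 2 ≤ CΘ ^ 2 := fun y => by
    have h := hCΘ y
    rw [← sq_abs]; exact pow_le_pow_left₀ (abs_nonneg _) h 2
  have hHΘ : ∀ y, 0 ≤ H (Φ' t y) * Θ y ^ 2 ∧ H (Φ' t y) * Θ y ^ 2 ≤ H 0 * CΘ ^ 2 := fun y =>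
    ⟨mul_nonneg (hbd y).1 (sq_nonneg _), mul_le_mul (hbd y).2 (hΘsq y) (sq_nonneg _) ((hbd y).1.trans (hbd y).2)⟩
  -- integrable indicator sums
  have hind : ∀ i : ℕ, Integrable ((ball (x i) (4 * r i)).indicator fun _ : EuclideanSpace ℝ (Fin 3) => (1 : ℝ)) :=
    fun i => (integrable_indicator_iff measurableSet_ball).2 (integrableOn_const (C := (1 : ℝ)) measure_ball_lt_top.ne)
  have hint_ind : ∀ D : Finset ℕ, ∫ y, ∑ i ∈ D, (ball (x i) (4 * r i)).indicator (fun _ => (1 : ℝ)) y =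
      ∑ i ∈ D, volume.real (ball (x i) (4 * r i)) := fun D => by
    rw [integral_finsetSum _ fun i _ => hind i]
    refine Finset.sum_congr rfl fun i _ => ?_
    rw [integral_indicator_const _ measurableSet_ball, smul_eq_mul, mul_one]
  have hintD : ∀ D : Finset ℕ, Integrable fun y => ∑ i ∈ D, (ball (x i) (4 * r i)).indicator (fun _ => (1 : ℝ)) y :=
    fun D => integrable_finsetSum _ fun i _ => hind i
  refine ⟨hIA, ?_, ?_, ?_⟩
  · -- (2) monotonicity
    refine integral_mono hIA hI0 fun y => ?_
    have h1 := (hpt y).1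
    have e : H (Φ' t y) * (Θ y * ∏ i ∈ A, (1 - ψ i y)) ^ 2 =
        H (Φ' t y) * Θ y ^ 2 * (∏ i ∈ A, (1 - ψ i y)) ^ 2 := by ring
    rw [e]
    exact mul_le_of_le_one_right (hHΘ y).1 h1.2
  · -- (3) near-mass
    rw [← integral_sub hI0 hIA]
    calc ∫ y, (H (Φ' t y) * Θ y ^ 2 - H (Φ' t y) * (Θ y * ∏ i ∈ A, (1 - ψ i y)) ^ 2)
        ≤ ∫ y, H 0 * CΘ ^ 2 * ∑ i ∈ A, (ball (x i) (4 * r i)).indicator (fun _ => (1 : ℝ)) y := by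
          refine integral_mono (hI0.sub hIA) ((hintD A).const_mul _) fun y => ?_
          have h2 := (hpt y).2.1
          have e : H (Φ' t y) * Θ y ^ 2 - H (Φ' t y) * (Θ y * ∏ i ∈ A, (1 - ψ i y)) ^ 2 =
              H (Φ' t y) * Θ y ^ 2 * (1 - (∏ i ∈ A, (1 - ψ i y)) ^ 2) := by ring
          rw [e]
          exact mul_le_mul (hHΘ y).2 h2.2 h2.1 (mul_nonneg (hH0 0) (sq_nonneg _))
      _ = H 0 * CΘ ^ 2 * ∑ i ∈ A, volume.real (ball (x i) (4 * r i)) := by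
          rw [integral_const_mul, hint_ind A]
  · -- (4) junction jump
    rw [← integral_sub hIA hIB]
    refine (abs_integral_le_integral_abs).trans ?_
    calc ∫ y, |H (Φ' t y) * (Θ y * ∏ i ∈ A, (1 - ψ i y)) ^ 2 - H (Φ' t y) * (Θ y * ∏ i ∈ B, (1 - ψ i y)) ^ 2|
        ≤ ∫ y, H 0 * CΘ ^ 2 * (∑ i ∈ A \ B, (ball (x i) (4 * r i)).indicator (fun _ => (1 : ℝ)) y +
            ∑ i ∈ B \ A, (ball (x i) (4 * r i)).indicator (fun _ => (1 : ℝ)) y) := by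
          refine integral_mono (hIA.sub hIB).abs (((hintD (A \ B)).add (hintD (B \ A))).const_mul _) fun y => ?_
          have h3 := (hpt y).2.2
          have e : H (Φ' t y) * (Θ y * ∏ i ∈ A, (1 - ψ i y)) ^ 2 - H (Φ' t y) * (Θ y * ∏ i ∈ B, (1 - ψ i y)) ^ 2 =
              H (Φ' t y) * Θ y ^ 2 * ((∏ i ∈ A, (1 - ψ i y)) ^ 2 - (∏ i ∈ B, (1 - ψ i y)) ^ 2) := by ring
          rw [e, abs_mul, abs_of_nonneg (hHΘ y).1]
          exact mul_le_mul (hHΘ y).2 h3 (abs_nonneg _) (mul_nonneg (hH0 0) (sq_nonneg _))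
      _ = H 0 * CΘ ^ 2 * (∑ i ∈ A \ B, volume.real (ball (x i) (4 * r i)) +
            ∑ i ∈ B \ A, volume.real (ball (x i) (4 * r i))) := by
          rw [integral_const_mul, integral_add (hintD _) (hintD _), hint_ind, hint_ind]

end Summit.NavierStokesRegularity.NavierStokesRegularity.Theorems.AxisymmetricKatoGlobal.EulerScaling

end
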